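import Summits.QuantumFields.BalabanUV.Beta.FP.DressedWordsPacked

/-!
# `BalabanUV.Beta.FP.DirectionalDoorKernelLaw` — road «FP» for binder row D1, ROUTE T, THE LEVEL-0 ASSEMBLY, STEP 1 IN ABSTRACT FORM (memo `N2B-DESIGN.md`
# (31d) ∕ (32e), TID § F.10 (L1)): **A GRADED DOOR THAT HOLDS FOR EVERY DIRECTION, WITH JETS LINEAR ∕ BILINEAR IN THE DIRECTION AND A FREE ORDER-2 SLOT,
# IS AN IDENTITY OF THREE TWO-POINT KERNELS ON EVERY FINITE FAMILY OF DIRECTIONS** (OWNER #33)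

WHY.  The (STEP) door of record (U21 `…LevelZeroSymULowClosedLamW2Q2` and its successor with R-FP-59's companion pair) is ONE identity
`secondVar N = secondVar F + secondVar G` of three GRADED zero-slice bordered systems, stated for EVERY direction `(h, λ)` and EVERY admissible free
order-2 matrix `G` (`Gᵀ = G`), whose jets are given by defining equations that are LINEAR (order 1) ∕ BILINEAR (order 2) in the direction, the free slot
entering the three second-order form jets additively through fixed linear maps (identity on the one-shot and fine form blocks, `G ↦ (L·G·I)₁₁` on the coarse
one).  #20 `SecondVarKernelLaw.mixedVar_kernel_law_of_secondVar_law_graded` turns such a law, once PACKED over a finite family of directions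
`v = Σ_k r_k • d_k` with packed tables, into the identity of three torus kernels per direction pair.  THIS FILE is the bridge in ABSTRACT form: the direction
space `V` and the free-slot space `W` are arbitrary real modules, the jets are FUNCTIONS of the direction with ONE linearity hypothesis per slot
(`∀ c x y, J (c • x + y) = c • J x + J y`), the free slot is governed by an arbitrary admissibility predicate `P` — so the theorem serves U21, its successor,
and the composite calls #21 alike, and the concrete assembly `FP/NestedStepLawLatticeKernelLevelZero` reduces to: one linearity lemma per jet of the U-file
(each a `Finset.sum` bookkeeping over its defining equation — #26 `PackedRepacking`, #32 `DressedWordsPacked` for the dressed coarse words and the commutator)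
+ ONE call of `mixedVar_kernel_law_of_directional_door`.
* §1 `add_of_lin ∕ zero_of_lin ∕ smul_of_lin` (the one-hypothesis linearity currency), `pack₁_of_lin`, `pack₁₁_of_lin` (double families), `pack₂_of_lin`
  (bilinear maps of ONE direction read in two slots) — corollaries of #32 §1's pair lemmas;
* §2 `packedSecond_eq ∕ packedSecond_eq'` — the packed, SYMMETRISED second-order family with ∕ without the free slot (+ `transpose_sum_sum_smul_of_swap`:
  the packed free slot is a symmetric matrix when `(E k l)ᵀ = E l k` — §3's `hP` at `P G :↔ Gᵀ = G`): `Σ_{k,l} (r_k r_l) • (½•(X₂ (d k) (d l) + X₂ (d l) (d k)) + Φ (E k l))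
  = X₂ v v + Φ (Σ_{k,l} (r_k r_l) • E k l)` (`v = Σ r•d`; #20 `sum_sum_smul_symmetrise`);
* §3 **`mixedVar_kernel_law_of_directional_door`** — THE THEOREM: door `∀ v ∀ E, P E → secondVar N₀ J_N(v,E) = secondVar F₀ J_F(v,E) + secondVar G₀ J_G(v,E)`
  with graded jets `[[X₁ v, −[Y₁ v;0]ᵀ],[[Y₁ v;0],0]]`, `kkt (X₂ v v + Φ_X E) [Y₂ v v; 0]`, all slots linear ⟹ for every family `d : σ → V`, every
  symmetric free family `E : σ → σ → W` with `P (ΣΣ r_k r_l • E k l)` for all weights, and every pair `(a, b)`: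
  `mixedVar N₀ J_N(a) J_N(b) J_N(a,b) = mixedVar F₀ … + mixedVar G₀ …` with the SYMMETRISED second-order families `½•(X₂ (d a) (d b) + X₂ (d b) (d a)) + Φ_X (E a b)`.
* §4 the LINEARITY CALCULUS in the one-hypothesis currency — `lin_sum_smul` (table families `Σ_b x b • T b`), `bilin_sum_sum_smul_left∕right` (bi-table families),
  `lin_comp` (precomposition with a linear map of directions: `h = Θ·h̄`, `λ = λ(h̄)`, `h′ = h + Dλ`), `lin_add`, `lin_const_smul`, `lin_post` (`toBlocks₁₁`, `[·;0]`,
  `L·(·)·I`), `bilin_mul_left∕right` (products of linear matrix jets) — of which the assembly's per-jet lemmas are instances.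
[folklore] finite (bi)linear algebra; no `def`, no `def … : Prop`, nothing cited, 0 sorry; 0 estimates.  NOT HERE: any U21 binder or table, the per-jet linearity
lemmas of the concrete door themselves (the assembly's), legs (#24), de-periodisation ((P2‴)), the END (#28∕#30d∕#31).

HONEST DEPENDENCY (page 1, mandatory): continuum YM on T⁴ ⇐ BetaPertH ∧ nine spine estimates (0/9 proved); BetaPertH ⇐ (D1) ∧ (D4) ∧ CAP+tail;
G-an2-4 gates asym, D1 and NE2/3/4.  HONEST FRAMING (cell contract, verbatim): «discharging `BetaPertH` makes Bałaban's UV stability UNCONDITIONAL —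
a real constructive-QFT result; it is NOT the continuum limit and NOT the Clay problem.»  ABSOLUTE RULE (cell charter, verbatim): «No internally-minted
statement may enter as a cited fact. Every hypothesis is either kernel-proved in this package or a verbatim quotation of a PUBLISHED theorem with page
reference. The manuscript(s) under audit are NOT citable for their own disputed steps — they are the thing under adjudication; programme-internal
(2001/route/tribunal) claims are never citable.»  [folklore]; nothing of Bałaban's asserted; 0 estimates; 0∕4 row-D1 binders (hW, hR, D1Tel, D1Rep);
NOT (T-ID), NOT SDF, NOT D1, NOT BetaPertH, NOT continuum, NOT Clay.  Road «FP» OWNER, b2b-balaban-beta-d1-p3 gen 24, 2026-08-23.  No existing file touched.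
-/

noncomputable section

open scoped BigOperators Matrix

namespace Summit.QuantumFields.BalabanUV.Beta.FP.DirectionalDoorKernelLaw

open Matrix
open Literature.MathematicalPhysics.QuantumFieldTheory.Balaban1983to89.Beta.Composition (kkt)
open Summit.QuantumFields.BalabanUV.Beta.D1BFx.LogDetSecondVariation (secondVar)
open Summit.QuantumFields.BalabanUV.Beta.FP.SecondVarPolarisation (mixedVar)
open Summit.QuantumFields.BalabanUV.Beta.FP.SecondVarKernelLaw (mixedVar_kernel_law_of_secondVar_law_graded sum_sum_smul_symmetrise)
open Summit.QuantumFields.BalabanUV.Beta.FP.DressedWordsPacked (pack_pair_of_add_smul pack_pair₂_of_add_smul)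

/-! ## §1 The one-hypothesis linearity currency and its packing corollaries -/

section Lin

variable {V M σ : Type*} [AddCommGroup V] [Module ℝ V] [AddCommGroup M] [Module ℝ M] [Fintype σ]

/-- [folklore] `φ (c • x + y) = c • φ x + φ y` for all `c x y` gives additivity. -/
theorem add_of_lin (φ : V → M) (h : ∀ (c : ℝ) (x y : V), φ (c • x + y) = c • φ x + φ y) (x y : V) : φ (x + y) = φ x + φ y := by
  simpa using h 1 x y

/-- [folklore] … and `φ 0 = 0`. -/
theorem zero_of_lin (φ : V → M) (h : ∀ (c : ℝ) (x y : V), φ (c • x + y) = c • φ x + φ y) : φ 0 = 0 := by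
  have h1 := h 1 0 0
  simp only [one_smul, add_zero] at h1
  -- `φ 0 = φ 0 + φ 0`
  have : φ 0 + φ 0 = φ 0 + 0 := by rw [add_zero]; exact h1.symm
  exact add_left_cancel this

/-- [folklore] … and homogeneity. -/
theorem smul_of_lin (φ : V → M) (h : ∀ (c : ℝ) (x y : V), φ (c • x + y) = c • φ x + φ y) (c : ℝ) (x : V) : φ (c • x) = c • φ x := by
  simpa [zero_of_lin φ h] using h c x 0

/-- [folklore] **ONE-SLOT PACKING**: a linear `φ` packs a weighted family — `φ (Σ_k r_k • d k) = Σ_k r_k • φ (d k)`. -/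
theorem pack₁_of_lin (φ : V → M) (h : ∀ (c : ℝ) (x y : V), φ (c • x + y) = c • φ x + φ y) (r : σ → ℝ) (d : σ → V) :
    φ (∑ k, r k • d k) = ∑ k, r k • φ (d k) :=
  pack_pair_of_add_smul (fun x (_ : V) => φ x) (fun a a' _ _ => add_of_lin φ h a a') (fun c a _ => smul_of_lin φ h c a) r d d

/-- [folklore] **DOUBLE-FAMILY PACKING**: `φ (Σ_k Σ_l c k l • x k l) = Σ_k Σ_l c k l • φ (x k l)`. -/
theorem pack₁₁_of_lin (φ : V → M) (h : ∀ (c : ℝ) (x y : V), φ (c • x + y) = c • φ x + φ y) (c : σ → σ → ℝ) (x : σ → σ → V) :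
    φ (∑ k, ∑ l, c k l • x k l) = ∑ k, ∑ l, c k l • φ (x k l) := by
  have h1 : φ (∑ k, (1 : ℝ) • ∑ l, c k l • x k l) = ∑ k, (1 : ℝ) • φ (∑ l, c k l • x k l) :=
    pack₁_of_lin φ h (fun _ => (1 : ℝ)) (fun k => ∑ l, c k l • x k l)
  simp only [one_smul] at h1
  rw [h1]
  exact Finset.sum_congr rfl fun k _ => pack₁_of_lin φ h (c k) (x k)

/-- [folklore] **TWO-SLOT PACKING OF ONE DIRECTION**: a map linear in each of two slots packs to a double sum along `v = Σ r•d` read in both slots —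
`ψ v v = Σ_k Σ_l (r_k·r_l) • ψ (d k) (d l)`. -/
theorem pack₂_of_lin (ψ : V → V → M) (hl : ∀ (c : ℝ) (x y z : V), ψ (c • x + y) z = c • ψ x z + ψ y z)
    (hr : ∀ (c : ℝ) (x y z : V), ψ x (c • y + z) = c • ψ x y + ψ x z) (r : σ → ℝ) (d : σ → V) :
    ψ (∑ k, r k • d k) (∑ l, r l • d l) = ∑ k, ∑ l, (r k * r l) • ψ (d k) (d l) :=
  pack_pair₂_of_add_smul (fun a₁ (_ : V) b₁ (_ : V) => ψ a₁ b₁)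
    (fun a a' _ _ b _ => add_of_lin (fun x => ψ x b) (fun c x y => hl c x y b) a a')
    (fun c a _ b _ => smul_of_lin (fun x => ψ x b) (fun c x y => hl c x y b) c a)
    (fun a _ b b' _ _ => add_of_lin (ψ a) (fun c x y => hr c a x y) b b')
    (fun c a _ b _ => smul_of_lin (ψ a) (fun c x y => hr c a x y) c b) r d d d d

end Lin

/-! ## §2 The packed, symmetrised second-order family with the free slot -/

section Second

variable {V W M σ : Type*} [AddCommGroup V] [Module ℝ V] [AddCommGroup W] [Module ℝ W] [AddCommGroup M] [Module ℝ M] [Fintype σ]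

/-- [folklore] **THE PACKED SECOND-ORDER FAMILY**: for `X₂` linear in each slot, `Φ` linear, a direction family `d` and a free family `E`, along `v = Σ_k r_k • d k`:
`Σ_k Σ_l (r_k·r_l) • (½•(X₂ (d k) (d l) + X₂ (d l) (d k)) + Φ (E k l)) = X₂ v v + Φ (Σ_k Σ_l (r_k·r_l) • E k l)` — the symmetrisation costs nothing
(#20 `sum_sum_smul_symmetrise`), the free slot rides linearly. -/
theorem packedSecond_eq (X₂ : V → V → M) (hl : ∀ (c : ℝ) (x y z : V), X₂ (c • x + y) z = c • X₂ x z + X₂ y z)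
    (hr : ∀ (c : ℝ) (x y z : V), X₂ x (c • y + z) = c • X₂ x y + X₂ x z)
    (Φ : W → M) (hΦ : ∀ (c : ℝ) (x y : W), Φ (c • x + y) = c • Φ x + Φ y) (r : σ → ℝ) (d : σ → V) (E : σ → σ → W) :
    ∑ k, ∑ l, (r k * r l) • ((1 / 2 : ℝ) • (X₂ (d k) (d l) + X₂ (d l) (d k)) + Φ (E k l))
      = X₂ (∑ k, r k • d k) (∑ l, r l • d l) + Φ (∑ k, ∑ l, (r k * r l) • E k l) := by
  have hsplit : ∀ k l, (r k * r l) • ((1 / 2 : ℝ) • (X₂ (d k) (d l) + X₂ (d l) (d k)) + Φ (E k l))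
      = (r k * r l) • ((1 / 2 : ℝ) • (X₂ (d k) (d l) + X₂ (d l) (d k))) + (r k * r l) • Φ (E k l) := fun k l => smul_add _ _ _
  simp only [hsplit, Finset.sum_add_distrib]
  rw [sum_sum_smul_symmetrise r (fun k l => X₂ (d k) (d l)), pack₂_of_lin X₂ hl hr r d, pack₁₁_of_lin Φ hΦ]

/-- [folklore] The same WITHOUT a free slot (the borders): `Σ_k Σ_l (r_k·r_l) • ½•(Y₂ (d k) (d l) + Y₂ (d l) (d k)) = Y₂ v v`. -/
theorem packedSecond_eq' (Y₂ : V → V → M) (hl : ∀ (c : ℝ) (x y z : V), Y₂ (c • x + y) z = c • Y₂ x z + Y₂ y z)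
    (hr : ∀ (c : ℝ) (x y z : V), Y₂ x (c • y + z) = c • Y₂ x y + Y₂ x z) (r : σ → ℝ) (d : σ → V) :
    ∑ k, ∑ l, (r k * r l) • ((1 / 2 : ℝ) • (Y₂ (d k) (d l) + Y₂ (d l) (d k))) = Y₂ (∑ k, r k • d k) (∑ l, r l • d l) := by
  rw [sum_sum_smul_symmetrise r (fun k l => Y₂ (d k) (d l)), pack₂_of_lin Y₂ hl hr r d]

/-- [folklore] **ADMISSIBILITY OF THE PACKED FREE SLOT, SYMMETRIC-MATRIX CASE** (U21's `hGt : Gᵀ = G`): if `(E k l)ᵀ = E l k` for all `k l` then every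
packing `Σ_{k,l} (r_k·r_l) • E k l` is a symmetric matrix — the `hP` input of §3 at `P G :↔ Gᵀ = G`. -/
theorem transpose_sum_sum_smul_of_swap {ι : Type*} (r : σ → ℝ) (E : σ → σ → Matrix ι ι ℝ) (hE : ∀ k l, (E k l)ᵀ = E l k) :
    (∑ k, ∑ l, (r k * r l) • E k l)ᵀ = ∑ k, ∑ l, (r k * r l) • E k l := by
  simp only [Matrix.transpose_sum, Matrix.transpose_smul, hE]
  rw [Finset.sum_comm]
  exact Finset.sum_congr rfl fun k _ => Finset.sum_congr rfl fun l _ => by rw [mul_comm]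

end Second

/-! ## §3 The theorem: a directional door is a kernel door -/

section Door

variable {V W : Type*} [AddCommGroup V] [Module ℝ V] [AddCommGroup W] [Module ℝ W]
variable {ν₁ κ₁ ρ₁ ν₂ κ₂ ρ₂ ν₃ κ₃ ρ₃ σ : Type*}
  [Fintype ν₁] [Fintype κ₁] [Fintype ρ₁] [DecidableEq ν₁] [DecidableEq κ₁] [DecidableEq ρ₁]
  [Fintype ν₂] [Fintype κ₂] [Fintype ρ₂] [DecidableEq ν₂] [DecidableEq κ₂] [DecidableEq ρ₂]
  [Fintype ν₃] [Fintype κ₃] [Fintype ρ₃] [DecidableEq ν₃] [DecidableEq κ₃] [DecidableEq ρ₃]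
  [Fintype σ] [DecidableEq σ]

/-- [folklore] **A DIRECTIONAL GRADED DOOR IS AN IDENTITY OF THREE TWO-POINT KERNELS** (memo (32e) STEP 1, abstract form).  Three graded zero-slice bordered
systems `N` (base `N₀` — the one-shot literal), `F` (base `F₀` — the fine sliced system), `G` (base `G₀` — the coarse ∕ level-`(j+1)` sliced system); for
each, as FUNCTIONS of a direction `v : V`: a first-order form table `X₁ v`, a first-order border `Y₁ v`, a second-order form table `X₂ v v′` and border
`Y₂ v v′` (read on the diagonal), and a fixed linear map `Φ_X : W → (form block)` by which a FREE order-2 element `E : W` enters the second form jet; every slot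
LINEAR (`∀ c x y, J (c • x + y) = c • J x + J y`).  IF the door
`secondVar N₀ [[N₁ v, −[NY₁ v;0]ᵀ],[[NY₁ v;0],0]] (kkt (N₂ v v + Φ_N E) [NY₂ v v;0]) = secondVar F₀ (…F…) + secondVar G₀ (…G…)` holds for EVERY direction
`v` and EVERY admissible `E` (`P E`), THEN for every finite family of directions `d : σ → V`, every free family `E : σ → σ → W` symmetric in `(k,l)` whose
packings `Σ_{k,l} (r_k r_l) • E k l` are admissible for every weight, and every pair `(a, b)`:
`mixedVar N₀ J_N(a) J_N(b) J_N(a,b) = mixedVar F₀ J_F(a) J_F(b) J_F(a,b) + mixedVar G₀ J_G(a) J_G(b) J_G(a,b)` with first jets at `d a`, `d b` and the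
SYMMETRISED second jets `kkt (½•(X₂ (d a) (d b) + X₂ (d b) (d a)) + Φ_X (E a b)) [½•(Y₂ (d a) (d b) + Y₂ (d b) (d a)); 0]` — three torus kernels, #20 §5's
conclusion.  (At the door of record: `V` = the TOP-level directions `h̄` (level-1 bond functions; leaf-05 g34 W-4), every fine datum being a LINEAR image of
`h̄` — the nested column `h = Θ·h̄` (#29), the tree-gauge parameter `λ = λ(h̄)`, R-FP-59's companion `Λ₁ᴳ(h̄)` — so all slots stay linear in `h̄` (for U21
ALONE one may take `V = (fine bonds → ℝ) × (fine sites → ℝ)` for `(h, λ)`); `W = Matrix (fine bonds) (fine bonds) ℝ`, `P E ↔ Eᵀ = E`, `Φ_N = Φ_F = id`,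
`Φ_G E = (L·E·I)₁₁`; the N-jets are read along `h + Dλ`, the F-∕G-jets along `h`; `d k = h̄_k` = the indicator of the top bond `k`.) -/
theorem mixedVar_kernel_law_of_directional_door
    -- the one-shot system
    (N₀ : Matrix (ν₁ ⊕ (κ₁ ⊕ ρ₁)) (ν₁ ⊕ (κ₁ ⊕ ρ₁)) ℝ) (N₁ : V → Matrix ν₁ ν₁ ℝ) (NY₁ : V → Matrix κ₁ ν₁ ℝ)
    (N₂ : V → V → Matrix ν₁ ν₁ ℝ) (NY₂ : V → V → Matrix κ₁ ν₁ ℝ) (ΦN : W → Matrix ν₁ ν₁ ℝ)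
    (hN₁ : ∀ (c : ℝ) (x y : V), N₁ (c • x + y) = c • N₁ x + N₁ y) (hNY₁ : ∀ (c : ℝ) (x y : V), NY₁ (c • x + y) = c • NY₁ x + NY₁ y)
    (hN₂l : ∀ (c : ℝ) (x y z : V), N₂ (c • x + y) z = c • N₂ x z + N₂ y z) (hN₂r : ∀ (c : ℝ) (x y z : V), N₂ x (c • y + z) = c • N₂ x y + N₂ x z)
    (hNY₂l : ∀ (c : ℝ) (x y z : V), NY₂ (c • x + y) z = c • NY₂ x z + NY₂ y z) (hNY₂r : ∀ (c : ℝ) (x y z : V), NY₂ x (c • y + z) = c • NY₂ x y + NY₂ x z)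
    (hΦN : ∀ (c : ℝ) (x y : W), ΦN (c • x + y) = c • ΦN x + ΦN y)
    -- the fine system
    (F₀ : Matrix (ν₂ ⊕ (κ₂ ⊕ ρ₂)) (ν₂ ⊕ (κ₂ ⊕ ρ₂)) ℝ) (F₁ : V → Matrix ν₂ ν₂ ℝ) (FY₁ : V → Matrix κ₂ ν₂ ℝ)
    (F₂ : V → V → Matrix ν₂ ν₂ ℝ) (FY₂ : V → V → Matrix κ₂ ν₂ ℝ) (ΦF : W → Matrix ν₂ ν₂ ℝ)
    (hF₁ : ∀ (c : ℝ) (x y : V), F₁ (c • x + y) = c • F₁ x + F₁ y) (hFY₁ : ∀ (c : ℝ) (x y : V), FY₁ (c • x + y) = c • FY₁ x + FY₁ y)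
    (hF₂l : ∀ (c : ℝ) (x y z : V), F₂ (c • x + y) z = c • F₂ x z + F₂ y z) (hF₂r : ∀ (c : ℝ) (x y z : V), F₂ x (c • y + z) = c • F₂ x y + F₂ x z)
    (hFY₂l : ∀ (c : ℝ) (x y z : V), FY₂ (c • x + y) z = c • FY₂ x z + FY₂ y z) (hFY₂r : ∀ (c : ℝ) (x y z : V), FY₂ x (c • y + z) = c • FY₂ x y + FY₂ x z)
    (hΦF : ∀ (c : ℝ) (x y : W), ΦF (c • x + y) = c • ΦF x + ΦF y)
    -- the coarse system
    (G₀ : Matrix (ν₃ ⊕ (κ₃ ⊕ ρ₃)) (ν₃ ⊕ (κ₃ ⊕ ρ₃)) ℝ) (G₁ : V → Matrix ν₃ ν₃ ℝ) (GY₁ : V → Matrix κ₃ ν₃ ℝ)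
    (G₂ : V → V → Matrix ν₃ ν₃ ℝ) (GY₂ : V → V → Matrix κ₃ ν₃ ℝ) (ΦG : W → Matrix ν₃ ν₃ ℝ)
    (hG₁ : ∀ (c : ℝ) (x y : V), G₁ (c • x + y) = c • G₁ x + G₁ y) (hGY₁ : ∀ (c : ℝ) (x y : V), GY₁ (c • x + y) = c • GY₁ x + GY₁ y)
    (hG₂l : ∀ (c : ℝ) (x y z : V), G₂ (c • x + y) z = c • G₂ x z + G₂ y z) (hG₂r : ∀ (c : ℝ) (x y z : V), G₂ x (c • y + z) = c • G₂ x y + G₂ x z)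
    (hGY₂l : ∀ (c : ℝ) (x y z : V), GY₂ (c • x + y) z = c • GY₂ x z + GY₂ y z) (hGY₂r : ∀ (c : ℝ) (x y z : V), GY₂ x (c • y + z) = c • GY₂ x y + GY₂ x z)
    (hΦG : ∀ (c : ℝ) (x y : W), ΦG (c • x + y) = c • ΦG x + ΦG y)
    -- the free order-2 slot's admissibility and THE DOOR, for every direction and every admissible free element
    (P : W → Prop)
    (hdoor : ∀ (v : V) (E : W), P E →
      secondVar N₀
          (fromBlocks (N₁ v) (-(fromRows (NY₁ v) (0 : Matrix ρ₁ ν₁ ℝ))ᵀ) (fromRows (NY₁ v) (0 : Matrix ρ₁ ν₁ ℝ)) 0)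
          (kkt (N₂ v v + ΦN E) (fromRows (NY₂ v v) (0 : Matrix ρ₁ ν₁ ℝ)))
        = secondVar F₀
            (fromBlocks (F₁ v) (-(fromRows (FY₁ v) (0 : Matrix ρ₂ ν₂ ℝ))ᵀ) (fromRows (FY₁ v) (0 : Matrix ρ₂ ν₂ ℝ)) 0)
            (kkt (F₂ v v + ΦF E) (fromRows (FY₂ v v) (0 : Matrix ρ₂ ν₂ ℝ)))
          + secondVar G₀
            (fromBlocks (G₁ v) (-(fromRows (GY₁ v) (0 : Matrix ρ₃ ν₃ ℝ))ᵀ) (fromRows (GY₁ v) (0 : Matrix ρ₃ ν₃ ℝ)) 0)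
            (kkt (G₂ v v + ΦG E) (fromRows (GY₂ v v) (0 : Matrix ρ₃ ν₃ ℝ))))
    -- a finite family of directions, a symmetric free family admissible at every packing, a pair
    (d : σ → V) (E : σ → σ → W) (hEs : ∀ k l, E k l = E l k) (hP : ∀ r : σ → ℝ, P (∑ k, ∑ l, (r k * r l) • E k l)) (a b : σ) :
    mixedVar N₀
        (fromBlocks (N₁ (d a)) (-(fromRows (NY₁ (d a)) (0 : Matrix ρ₁ ν₁ ℝ))ᵀ) (fromRows (NY₁ (d a)) (0 : Matrix ρ₁ ν₁ ℝ)) 0)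
        (fromBlocks (N₁ (d b)) (-(fromRows (NY₁ (d b)) (0 : Matrix ρ₁ ν₁ ℝ))ᵀ) (fromRows (NY₁ (d b)) (0 : Matrix ρ₁ ν₁ ℝ)) 0)
        (kkt ((1 / 2 : ℝ) • (N₂ (d a) (d b) + N₂ (d b) (d a)) + ΦN (E a b))
          (fromRows ((1 / 2 : ℝ) • (NY₂ (d a) (d b) + NY₂ (d b) (d a))) (0 : Matrix ρ₁ ν₁ ℝ)))
      = mixedVar F₀
          (fromBlocks (F₁ (d a)) (-(fromRows (FY₁ (d a)) (0 : Matrix ρ₂ ν₂ ℝ))ᵀ) (fromRows (FY₁ (d a)) (0 : Matrix ρ₂ ν₂ ℝ)) 0)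
          (fromBlocks (F₁ (d b)) (-(fromRows (FY₁ (d b)) (0 : Matrix ρ₂ ν₂ ℝ))ᵀ) (fromRows (FY₁ (d b)) (0 : Matrix ρ₂ ν₂ ℝ)) 0)
          (kkt ((1 / 2 : ℝ) • (F₂ (d a) (d b) + F₂ (d b) (d a)) + ΦF (E a b))
            (fromRows ((1 / 2 : ℝ) • (FY₂ (d a) (d b) + FY₂ (d b) (d a))) (0 : Matrix ρ₂ ν₂ ℝ)))
        + mixedVar G₀
          (fromBlocks (G₁ (d a)) (-(fromRows (GY₁ (d a)) (0 : Matrix ρ₃ ν₃ ℝ))ᵀ) (fromRows (GY₁ (d a)) (0 : Matrix ρ₃ ν₃ ℝ)) 0)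
          (fromBlocks (G₁ (d b)) (-(fromRows (GY₁ (d b)) (0 : Matrix ρ₃ ν₃ ℝ))ᵀ) (fromRows (GY₁ (d b)) (0 : Matrix ρ₃ ν₃ ℝ)) 0)
          (kkt ((1 / 2 : ℝ) • (G₂ (d a) (d b) + G₂ (d b) (d a)) + ΦG (E a b))
            (fromRows ((1 / 2 : ℝ) • (GY₂ (d a) (d b) + GY₂ (d b) (d a))) (0 : Matrix ρ₃ ν₃ ℝ))) := by
  refine mixedVar_kernel_law_of_secondVar_law_graded N₀ (fun k => N₁ (d k)) (fun k l => (1 / 2 : ℝ) • (N₂ (d k) (d l) + N₂ (d l) (d k)) + ΦN (E k l))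
    (fun k => NY₁ (d k)) (fun k l => (1 / 2 : ℝ) • (NY₂ (d k) (d l) + NY₂ (d l) (d k)))
    F₀ (fun k => F₁ (d k)) (fun k l => (1 / 2 : ℝ) • (F₂ (d k) (d l) + F₂ (d l) (d k)) + ΦF (E k l))
    (fun k => FY₁ (d k)) (fun k l => (1 / 2 : ℝ) • (FY₂ (d k) (d l) + FY₂ (d l) (d k)))
    G₀ (fun k => G₁ (d k)) (fun k l => (1 / 2 : ℝ) • (G₂ (d k) (d l) + G₂ (d l) (d k)) + ΦG (E k l))
    (fun k => GY₁ (d k)) (fun k l => (1 / 2 : ℝ) • (GY₂ (d k) (d l) + GY₂ (d l) (d k)))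
    (fun k l => by rw [add_comm (N₂ (d k) (d l)), hEs k l]) (fun k l => by rw [add_comm (NY₂ (d k) (d l))])
    (fun k l => by rw [add_comm (F₂ (d k) (d l)), hEs k l]) (fun k l => by rw [add_comm (FY₂ (d k) (d l))])
    (fun k l => by rw [add_comm (G₂ (d k) (d l)), hEs k l]) (fun k l => by rw [add_comm (GY₂ (d k) (d l))])
    (fun r => ?_) a b
  -- the law for the weight `r` IS the door at `v := Σ r•d`, `E := ΣΣ rr•E`
  rw [← pack₁_of_lin N₁ hN₁ r d, ← pack₁_of_lin NY₁ hNY₁ r d, ← pack₁_of_lin F₁ hF₁ r d, ← pack₁_of_lin FY₁ hFY₁ r d,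
    ← pack₁_of_lin G₁ hG₁ r d, ← pack₁_of_lin GY₁ hGY₁ r d,
    packedSecond_eq N₂ hN₂l hN₂r ΦN hΦN r d E, packedSecond_eq F₂ hF₂l hF₂r ΦF hΦF r d E, packedSecond_eq G₂ hG₂l hG₂r ΦG hΦG r d E,
    packedSecond_eq' NY₂ hNY₂l hNY₂r r d, packedSecond_eq' FY₂ hFY₂l hFY₂r r d, packedSecond_eq' GY₂ hGY₂l hGY₂r r d]
  exact hdoor _ _ (hP r)

end Door

/-! ## §4 Linearity calculus in the one-hypothesis currency (the assembly's per-jet lemmas are instances) -/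

section Calculus

variable {V M M' β : Type*} [AddCommGroup V] [Module ℝ V] [AddCommGroup M] [Module ℝ M] [AddCommGroup M'] [Module ℝ M'] [Fintype β]

/-- [folklore] **A TABLE FAMILY WEIGHTED BY THE DIRECTION IS LINEAR**: `x ↦ Σ_b x b • T b` (U21's `hH₁ hW₁ hDb₁ hQ₁₁ …` shapes, the direction being the
bond function itself). -/
theorem lin_sum_smul (T : β → M) (c : ℝ) (x y : β → ℝ) :
    (∑ b, (c • x + y) b • T b) = c • (∑ b, x b • T b) + ∑ b, y b • T b := by
  simp only [Pi.add_apply, Pi.smul_apply, smul_eq_mul, add_smul, mul_smul, Finset.sum_add_distrib, Finset.smul_sum]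

/-- [folklore] **A BI-TABLE FAMILY IS LINEAR IN ITS LEFT WEIGHT** (`x y ↦ Σ_b Σ_b′ (x b·y b′) • T b b′`, U21's `hH₂ hQ₁₂ hQ₂₂` shapes). -/
theorem bilin_sum_sum_smul_left (T : β → β → M) (c : ℝ) (x y z : β → ℝ) :
    (∑ b, ∑ b', ((c • x + y) b * z b') • T b b') = c • (∑ b, ∑ b', (x b * z b') • T b b') + ∑ b, ∑ b', (y b * z b') • T b b' := by
  simp only [Pi.add_apply, Pi.smul_apply, smul_eq_mul, add_mul, add_smul, mul_assoc, mul_smul, Finset.sum_add_distrib, Finset.smul_sum]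

/-- [folklore] … and in its RIGHT weight. -/
theorem bilin_sum_sum_smul_right (T : β → β → M) (c : ℝ) (x y z : β → ℝ) :
    (∑ b, ∑ b', (x b * (c • y + z) b') • T b b') = c • (∑ b, ∑ b', (x b * y b') • T b b') + ∑ b, ∑ b', (x b * z b') • T b b' := by
  simp only [Pi.add_apply, Pi.smul_apply, smul_eq_mul, mul_add, add_smul, mul_left_comm (x _) c, mul_smul, Finset.sum_add_distrib,
    Finset.smul_sum]

/-- [folklore] **PRECOMPOSITION WITH A LINEAR MAP OF DIRECTIONS** (`h = Θ·h̄`, `λ = λ(h̄)`, `h′ = h + Dλ`): if `φ` is linear and `A : V → V′` is linear then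
`φ ∘ A` is linear. -/
theorem lin_comp {V' : Type*} [AddCommGroup V'] [Module ℝ V'] (φ : V' → M) (hφ : ∀ (c : ℝ) (x y : V'), φ (c • x + y) = c • φ x + φ y)
    (A : V → V') (hA : ∀ (c : ℝ) (x y : V), A (c • x + y) = c • A x + A y) (c : ℝ) (x y : V) :
    φ (A (c • x + y)) = c • φ (A x) + φ (A y) := by
  rw [hA, hφ]

/-- [folklore] **SUMS OF LINEAR JETS ARE LINEAR** (a form slot `= table part + companion part`). -/
theorem lin_add (φ ψ : V → M) (hφ : ∀ (c : ℝ) (x y : V), φ (c • x + y) = c • φ x + φ y)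
    (hψ : ∀ (c : ℝ) (x y : V), ψ (c • x + y) = c • ψ x + ψ y) (c : ℝ) (x y : V) :
    φ (c • x + y) + ψ (c • x + y) = c • (φ x + ψ x) + (φ y + ψ y) := by
  rw [hφ, hψ, smul_add]; abel

/-- [folklore] **A FIXED SCALAR WEIGHT KEEPS LINEARITY** (`w •`, `(−2c) •`). -/
theorem lin_const_smul (a : ℝ) (φ : V → M) (hφ : ∀ (c : ℝ) (x y : V), φ (c • x + y) = c • φ x + φ y) (c : ℝ) (x y : V) :
    a • φ (c • x + y) = c • (a • φ x) + a • φ y := by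
  rw [hφ, smul_add, smul_comm]

/-- [folklore] **POSTCOMPOSITION WITH AN ADDITIVE HOMOGENEOUS MAP** (`toBlocks₁₁`, `fromRows · 0`, transpose, `L * · * I`): if `φ` is linear and `g` is
additive and homogeneous then `g ∘ φ` is linear. -/
theorem lin_post (φ : V → M) (hφ : ∀ (c : ℝ) (x y : V), φ (c • x + y) = c • φ x + φ y) (g : M → M')
    (hadd : ∀ a b, g (a + b) = g a + g b) (hsmul : ∀ (c : ℝ) a, g (c • a) = c • g a) (c : ℝ) (x y : V) :
    g (φ (c • x + y)) = c • g (φ x) + g (φ y) := by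
  rw [hφ, hadd, hsmul]

/-- [folklore] **THE PRODUCT OF TWO LINEAR MATRIX-VALUED JETS IS LINEAR IN THE LEFT FACTOR's DIRECTION** (the two-slot reading of a quadratic word, e.g. the
commutator `L(h)·E_λ`; cf. #32 `sum_smul_mul_sum_smul`). -/
theorem bilin_mul_left {ι κ ξ : Type*} [Fintype κ] (φ : V → Matrix ι κ ℝ) (ψ : V → Matrix κ ξ ℝ)
    (hφ : ∀ (c : ℝ) (x y : V), φ (c • x + y) = c • φ x + φ y) (c : ℝ) (x y z : V) :
    φ (c • x + y) * ψ z = c • (φ x * ψ z) + φ y * ψ z := by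
  rw [hφ, Matrix.add_mul, Matrix.smul_mul]

/-- [folklore] … and in the RIGHT factor's direction. -/
theorem bilin_mul_right {ι κ ξ : Type*} [Fintype κ] (φ : V → Matrix ι κ ℝ) (ψ : V → Matrix κ ξ ℝ)
    (hψ : ∀ (c : ℝ) (x y : V), ψ (c • x + y) = c • ψ x + ψ y) (c : ℝ) (x y z : V) :
    φ z * ψ (c • x + y) = c • (φ z * ψ x) + φ z * ψ y := by
  rw [hψ, Matrix.mul_add, Matrix.mul_smul]

end Calculus

end Summit.QuantumFields.BalabanUV.Beta.FP.DirectionalDoorKernelLaw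

end
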